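import Mathlib.MeasureTheory.Function.ConvergenceInMeasure
import Mathlib.MeasureTheory.Function.LpSpace.Complete
import Mathlib.Analysis.Calculus.BumpFunction.FiniteDimension
import Literature.Analysis.Fourier.MultiplierOpL2
import HarnessLib

/-!
# The `Ẇ^{1,p}` bound of a bounded multiplier passes from `C_c^∞` to Schwartz test functions

`HasGradientLpBoundWith p c M` (`Literature/Analysis/Fourier/SobolevMultiplierBound.lean`)
bounds `Σⱼ ‖M(D)∂ⱼφ‖_{Lᵖ}` by `c Σⱼ ‖∂ⱼφ‖_{Lᵖ}` for COMPACTLY SUPPORTED smooth `φ`, the class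
of [Rauch1986, (5) p. 483] ("`∀ φ ∈ C₀^∞`"). Rauch's next step (6) feeds in test functions of
the form `φ = 𝓕⁻¹(a f̂)` with `a` smooth and `f ∈ 𝒮`, which are Schwartz but not compactly
supported. This file PROVES the (routine, unprinted) extension: for a bounded, entrywise
measurable symbol `M` and `1 ≤ p < ∞`, the bound holds for every Schwartz `φ`, per component
of the gradient (`HasGradientLpBoundWith.eLpNorm_multiplierOp_partialDeriv_schwartz_le`; summing
over `j` costs a factor `d`).

Proof: truncate, `φ_n = η_n φ` with `η_n(x) = β(x/(n+1))`, `β` a fixed bump; then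
`∂ⱼφ_n - ∂ⱼφ = (η_n - 1)∂ⱼφ + (∂ⱼη_n)φ → 0` in every `L^q`, `1 ≤ q < ∞` (dominated convergence
and `|∂ⱼη_n| ≤ K/(n+1)`); `M(D)` is `L²`-bounded (`eLpNorm_multiplierOp_two_le`), so
`M(D)∂ⱼφ_n → M(D)∂ⱼφ` in `L²`, hence a.e. along a subsequence, and Fatou
(`eLpNorm_lim_le_liminf_eLpNorm`) gives `‖M(D)∂ⱼφ‖_p ≤ liminf ‖M(D)∂ⱼφ_n‖_p ≤ c Σ_l ‖∂_lφ‖_p`.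

## References

* [Rauch1986] J. Rauch, Comm. Math. Phys. 106 (1986) 481–484, Proof of Theorem p. 483, (5)–(6).
-/

noncomputable section

open MeasureTheory FourierTransform Filter Topology
open scoped SchwartzMap ENNReal NNReal ContDiff

namespace Literature.Analysis.Fourier

variable {d : ℕ} {ι κ : Type*} [Fintype ι] [Fintype κ]

/-! ### Spatial cut-offs `η_n(x) = β(x/(n+1))` -/

variable (d) in
/-- The standard bump on `ℝᵈ` at the origin: `= 1` on the closed unit ball, supported in the
ball of radius `2`. [folklore] -/
def spaceBump : ContDiffBump (0 : EuclideanSpace ℝ (Fin d)) :=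
  ⟨1, 2, one_pos, one_lt_two⟩

variable (d) in
/-- The spatial cut-off `η_n(x) = β(x/(n+1))`: smooth, `= 1` on `‖x‖ ≤ n+1`, values in `[0,1]`,
compactly supported, with gradient `O(1/(n+1))`. [folklore] -/
def spaceCutoff (n : ℕ) (x : EuclideanSpace ℝ (Fin d)) : ℝ :=
  spaceBump d (((n : ℝ) + 1)⁻¹ • x)

/-- `η_n` is smooth. [folklore] -/
theorem spaceCutoff_contDiff (n : ℕ) : ContDiff ℝ ∞ (spaceCutoff d n) :=
  (spaceBump d).contDiff.comp (contDiff_const_smul _)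

/-- `η_n` has compact support. [folklore] -/
theorem spaceCutoff_hasCompactSupport (n : ℕ) : HasCompactSupport (spaceCutoff d n) := by
  have hc : ((n : ℝ) + 1)⁻¹ ≠ 0 := by positivity
  exact (spaceBump d).hasCompactSupport.comp_homeomorph (Homeomorph.smulOfNeZero _ hc)

/-- `0 ≤ η_n`. [folklore] -/
theorem spaceCutoff_nonneg (n : ℕ) (x : EuclideanSpace ℝ (Fin d)) : 0 ≤ spaceCutoff d n x :=
  (spaceBump d).nonneg

/-- `η_n ≤ 1`. [folklore] -/
theorem spaceCutoff_le_one (n : ℕ) (x : EuclideanSpace ℝ (Fin d)) : spaceCutoff d n x ≤ 1 :=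
  (spaceBump d).le_one

/-- `|η_n - 1| ≤ 1`. [folklore] -/
theorem abs_spaceCutoff_sub_one_le (n : ℕ) (x : EuclideanSpace ℝ (Fin d)) :
    |spaceCutoff d n x - 1| ≤ 1 := by
  rw [abs_sub_comm, abs_of_nonneg (sub_nonneg.2 (spaceCutoff_le_one n x))]
  linarith [spaceCutoff_nonneg n x]

/-- `η_n(x) = 1` once `‖x‖ ≤ n + 1`. [folklore] -/
theorem spaceCutoff_eq_one {n : ℕ} {x : EuclideanSpace ℝ (Fin d)} (hx : ‖x‖ ≤ (n : ℝ) + 1) :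
    spaceCutoff d n x = 1 := by
  refine (spaceBump d).one_of_mem_closedBall ?_
  rw [Metric.mem_closedBall, dist_zero_right, norm_smul, Real.norm_eq_abs,
    abs_of_pos (by positivity)]
  show ((n : ℝ) + 1)⁻¹ * ‖x‖ ≤ 1
  rw [inv_mul_le_iff₀ (by positivity), mul_one]
  exact hx

/-- For every `x`, eventually `η_n(x) = 1`. [folklore] -/
theorem eventually_spaceCutoff_eq_one (x : EuclideanSpace ℝ (Fin d)) :
    ∀ᶠ n : ℕ in atTop, spaceCutoff d n x = 1 := by
  obtain ⟨N, hN⟩ := exists_nat_ge ‖x‖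
  filter_upwards [eventually_ge_atTop N] with n hn
  exact spaceCutoff_eq_one (hN.trans (by exact_mod_cast Nat.le_succ_of_le hn))

/-- A uniform bound for the gradient of the bump. [folklore] -/
theorem exists_bound_fderiv_spaceBump (d : ℕ) :
    ∃ K : ℝ, 0 ≤ K ∧ ∀ y, ‖fderiv ℝ (spaceBump d) y‖ ≤ K := by
  have hc : Continuous fun y => fderiv ℝ (spaceBump d) y :=
    ((spaceBump d).contDiff (n := 1)).continuous_fderiv (by norm_num)
  obtain ⟨K, hK⟩ := hc.bounded_above_of_compact_support ((spaceBump d).hasCompactSupport.fderiv ℝ)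
  exact ⟨max K 0, le_max_right _ _, fun y => (hK y).trans (le_max_left _ _)⟩

/-- `‖Dη_n(x)‖ ≤ K/(n+1)`. [folklore] -/
theorem norm_fderiv_spaceCutoff_le {K : ℝ} (hK : ∀ y, ‖fderiv ℝ (spaceBump d) y‖ ≤ K) (n : ℕ)
    (x : EuclideanSpace ℝ (Fin d)) : ‖fderiv ℝ (spaceCutoff d n) x‖ ≤ K * ((n : ℝ) + 1)⁻¹ := by
  set c : ℝ := ((n : ℝ) + 1)⁻¹ with hcdef
  have hc0 : 0 < c := by positivity
  have hL : HasFDerivAt (fun y : EuclideanSpace ℝ (Fin d) => c • y)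
      (c • ContinuousLinearMap.id ℝ _) x :=
    (ContinuousLinearMap.id ℝ _).hasFDerivAt.const_smul c
  have hcomp :=
    (((spaceBump d).contDiff (n := 1)).differentiable (by norm_num) (c • x)).hasFDerivAt.comp x hL
  have heq : spaceCutoff d n = (spaceBump d) ∘ fun y => c • y := rfl
  rw [heq, hcomp.fderiv]
  refine (ContinuousLinearMap.opNorm_comp_le _ _).trans ?_
  have hK0 : 0 ≤ K := (norm_nonneg _).trans (hK (c • x))
  have hid : ‖c • ContinuousLinearMap.id ℝ (EuclideanSpace ℝ (Fin d))‖ ≤ c := by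
    rw [norm_smul, Real.norm_eq_abs, abs_of_pos hc0]
    exact mul_le_of_le_one_right hc0.le ContinuousLinearMap.norm_id_le
  exact mul_le_mul (hK _) hid (norm_nonneg _) hK0

/-! ### Truncated test functions -/

/-- The truncation `φ_n = η_n φ` of a Schwartz function. [folklore] -/
def truncate (n : ℕ) (φ : EuclideanSpace ℝ (Fin d) → ι → ℂ) : EuclideanSpace ℝ (Fin d) → ι → ℂ :=
  fun x => spaceCutoff d n x • φ x

/-- `η_nφ` is smooth. [folklore] -/
theorem truncate_contDiff (n : ℕ) (φ : 𝓢(EuclideanSpace ℝ (Fin d), ι → ℂ)) :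
    ContDiff ℝ ∞ (truncate n ⇑φ) :=
  (spaceCutoff_contDiff n).smul (φ.smooth ⊤)

/-- `η_nφ` has compact support. [folklore] -/
theorem truncate_hasCompactSupport (n : ℕ) (φ : 𝓢(EuclideanSpace ℝ (Fin d), ι → ℂ)) :
    HasCompactSupport (truncate n ⇑φ) :=
  (spaceCutoff_hasCompactSupport n).smul_right

/-- `∂ⱼ(η_nφ) - ∂ⱼφ = (η_n - 1)∂ⱼφ + (∂ⱼη_n)φ`. [folklore] -/
theorem partialDeriv_truncate_sub (n : ℕ) (φ : 𝓢(EuclideanSpace ℝ (Fin d), ι → ℂ)) (j : Fin d)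
    (x : EuclideanSpace ℝ (Fin d)) :
    partialDeriv j (truncate n ⇑φ) x - partialDeriv j ⇑φ x =
      (spaceCutoff d n x - 1) • partialDeriv j ⇑φ x + partialDeriv j (spaceCutoff d n) x • φ x := by
  have h1 : DifferentiableAt ℝ (spaceCutoff d n) x :=
    ((spaceCutoff_contDiff n).differentiable (by simp)).differentiableAt
  have h2 : DifferentiableAt ℝ (⇑φ) x := φ.differentiableAt
  simp only [partialDeriv_apply]
  rw [show truncate n ⇑φ = fun y => spaceCutoff d n y • φ y from rfl, fderiv_fun_smul h1 h2,
    _root_.add_apply, _root_.smul_apply, ContinuousLinearMap.smulRight_apply, sub_smul, one_smul]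
  abel

/-! ### Convergence of the truncations in `L^q` -/

/-- Dominated convergence: `‖(η_n - 1) G‖_{L^q} → 0` for `G ∈ L^q`, `0 < q < ∞`. [folklore] -/
theorem tendsto_eLpNorm_cutoff_sub_one_smul {F : Type*} [NormedAddCommGroup F] [NormedSpace ℝ F]
    {G : EuclideanSpace ℝ (Fin d) → F} {q : ℝ≥0∞} (hq0 : q ≠ 0) (hq : q ≠ ⊤)
    (hG : MemLp G q volume) :
    Tendsto (fun n => eLpNorm (fun x => (spaceCutoff d n x - 1) • G x) q volume) atTop (𝓝 0) := by
  have hq0' : 0 < q.toReal := ENNReal.toReal_pos hq0 hq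
  -- the `q`-th powers converge by dominated convergence
  have hmeasG : AEStronglyMeasurable G volume := hG.aestronglyMeasurable
  have hmeas : ∀ n, AEStronglyMeasurable (fun x => (spaceCutoff d n x - 1) • G x) volume := fun n =>
    (((spaceCutoff_contDiff n).continuous.sub continuous_const).aestronglyMeasurable).smul hmeasG
  have hlin : Tendsto (fun n => ∫⁻ x, ‖(spaceCutoff d n x - 1) • G x‖ₑ ^ q.toReal) atTop (𝓝 0) := by
    have hbound : ∀ n, ∀ᵐ x ∂(volume : Measure (EuclideanSpace ℝ (Fin d))),
        ‖(spaceCutoff d n x - 1) • G x‖ₑ ^ q.toReal ≤ ‖G x‖ₑ ^ q.toReal := by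
      intro n
      refine Eventually.of_forall fun x => ENNReal.rpow_le_rpow ?_ hq0'.le
      rw [enorm_smul]
      refine mul_le_of_le_one_left zero_le ?_
      rw [← ofReal_norm, Real.norm_eq_abs]
      exact ENNReal.ofReal_le_one.2 (abs_spaceCutoff_sub_one_le n x)
    have hfin : ∫⁻ x, ‖G x‖ₑ ^ q.toReal ≠ ⊤ :=
      (lintegral_rpow_enorm_lt_top_of_eLpNorm_lt_top hq0 hq hG.eLpNorm_lt_top).ne
    have hlim : ∀ᵐ x ∂(volume : Measure (EuclideanSpace ℝ (Fin d))),
        Tendsto (fun n => ‖(spaceCutoff d n x - 1) • G x‖ₑ ^ q.toReal) atTop (𝓝 0) := by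
      refine Eventually.of_forall fun x => ?_
      have hev := eventually_spaceCutoff_eq_one (d := d) x
      refine tendsto_const_nhds.congr' ?_
      filter_upwards [hev] with n hn
      rw [hn, sub_self, zero_smul, enorm_zero, ENNReal.zero_rpow_of_pos hq0']
    have := tendsto_lintegral_of_dominated_convergence' (fun x => ‖G x‖ₑ ^ q.toReal)
      (fun n => ((hmeas n).enorm.pow_const _)) hbound hfin hlim
    simpa using this
  -- take `q`-th roots
  have hroot : Tendsto (fun t : ℝ≥0∞ => t ^ (1 / q.toReal)) (𝓝 0) (𝓝 0) := by
    have := (ENNReal.continuous_rpow_const (y := 1 / q.toReal)).tendsto 0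
    rwa [ENNReal.zero_rpow_of_pos (by positivity)] at this
  have h := hroot.comp hlin
  refine h.congr fun n => ?_
  rw [Function.comp_apply, eLpNorm_eq_lintegral_rpow_enorm_toReal hq0 hq]

/-- `‖(∂ⱼη_n) φ‖_{L^q} ≤ (K/(n+1)) ‖φ‖_{L^q} → 0`. [folklore] -/
theorem tendsto_eLpNorm_fderiv_cutoff_smul {F : Type*} [NormedAddCommGroup F] [NormedSpace ℝ F]
    {G : EuclideanSpace ℝ (Fin d) → F} {q : ℝ≥0∞} (hG : eLpNorm G q volume ≠ ⊤) (j : Fin d) :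
    Tendsto (fun n => eLpNorm (fun x => partialDeriv j (spaceCutoff d n) x • G x) q volume) atTop
      (𝓝 0) := by
  obtain ⟨K, hK0, hK⟩ := exists_bound_fderiv_spaceBump d
  have hpt : ∀ n x, ‖partialDeriv j (spaceCutoff d n) x • G x‖₊ ≤
      (K * ((n : ℝ) + 1)⁻¹).toNNReal * ‖G x‖₊ := by
    intro n x
    rw [nnnorm_smul, ← NNReal.coe_le_coe, NNReal.coe_mul, NNReal.coe_mul, coe_nnnorm, coe_nnnorm,
      Real.coe_toNNReal _ (by positivity)]
    refine mul_le_mul_of_nonneg_right ?_ (norm_nonneg _)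
    rw [partialDeriv_apply]
    refine ((fderiv ℝ (spaceCutoff d n) x).le_opNorm _).trans ?_
    rw [PiLp.norm_single, norm_one, mul_one]
    exact norm_fderiv_spaceCutoff_le hK n x
  have hle : ∀ n, eLpNorm (fun x => partialDeriv j (spaceCutoff d n) x • G x) q volume ≤
      ENNReal.ofReal (K * ((n : ℝ) + 1)⁻¹) * eLpNorm G q volume := by
    intro n
    have := eLpNorm_le_nnreal_smul_eLpNorm_of_ae_le_mul (Eventually.of_forall (hpt n)) q
      (μ := volume)
    simpa [ENNReal.smul_def, smul_eq_mul, ENNReal.ofReal] using this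
  have hlim : Tendsto (fun n : ℕ => ENNReal.ofReal (K * ((n : ℝ) + 1)⁻¹) * eLpNorm G q volume) atTop
      (𝓝 0) := by
    have h1 : Tendsto (fun n : ℕ => K * ((n : ℝ) + 1)⁻¹) atTop (𝓝 0) := by
      have := tendsto_one_div_add_atTop_nhds_zero_nat.const_mul K
      simpa [one_div] using this
    have h2 : Tendsto (fun n : ℕ => ENNReal.ofReal (K * ((n : ℝ) + 1)⁻¹)) atTop (𝓝 0) := by
      rw [← ENNReal.ofReal_zero]
      exact ENNReal.tendsto_ofReal h1
    have := ENNReal.Tendsto.mul_const h2 (Or.inr hG)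
    simpa using this
  exact tendsto_of_tendsto_of_tendsto_of_le_of_le tendsto_const_nhds hlim (fun _ => zero_le) hle

/-- **`∂ⱼ(η_nφ) → ∂ⱼφ` in `L^q`**, `1 ≤ q < ∞`, for Schwartz `φ`. [folklore] -/
theorem tendsto_eLpNorm_partialDeriv_truncate_sub (φ : 𝓢(EuclideanSpace ℝ (Fin d), ι → ℂ))
    (j : Fin d) {q : ℝ≥0∞} (hq1 : 1 ≤ q) (hq : q ≠ ⊤) :
    Tendsto (fun n => eLpNorm (partialDeriv j (truncate n ⇑φ) - partialDeriv j ⇑φ) q volume) atTop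
      (𝓝 0) := by
  have hq0 : q ≠ 0 := (zero_lt_one.trans_le hq1).ne'
  open LineDeriv in
  have hmem : MemLp (partialDeriv j ⇑φ) q volume :=
    (∂_{EuclideanSpace.single j (1 : ℝ)} φ : 𝓢(EuclideanSpace ℝ (Fin d), ι → ℂ)).memLp q volume
  have h1 := tendsto_eLpNorm_cutoff_sub_one_smul (d := d) hq0 hq hmem
  have h2 := tendsto_eLpNorm_fderiv_cutoff_smul (d := d) (G := ⇑φ) (φ.eLpNorm_lt_top q volume).ne j
  have hdec : ∀ n, partialDeriv j (truncate n ⇑φ) - partialDeriv j ⇑φ =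
      (fun x => (spaceCutoff d n x - 1) • partialDeriv j ⇑φ x) +
        fun x => partialDeriv j (spaceCutoff d n) x • φ x := by
    intro n; funext x; exact partialDeriv_truncate_sub n φ j x
  have hmeas1 : ∀ n, AEStronglyMeasurable (fun x => (spaceCutoff d n x - 1) • partialDeriv j ⇑φ x)
      volume := fun n =>
    (((spaceCutoff_contDiff n).continuous.sub continuous_const).aestronglyMeasurable).smul
      hmem.aestronglyMeasurable
  have hmeas2 : ∀ n,
      AEStronglyMeasurable (fun x => partialDeriv j (spaceCutoff d n) x • φ x) volume := fun n => by
      have hsc : Continuous fun x => partialDeriv j (spaceCutoff d n) x :=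
        ((spaceCutoff_contDiff n).continuous_fderiv (by simp)).clm_apply continuous_const
      exact hsc.aestronglyMeasurable.smul φ.continuous.aestronglyMeasurable
  have hle : ∀ n, eLpNorm (partialDeriv j (truncate n ⇑φ) - partialDeriv j ⇑φ) q volume ≤
      eLpNorm (fun x => (spaceCutoff d n x - 1) • partialDeriv j ⇑φ x) q volume +
        eLpNorm (fun x => partialDeriv j (spaceCutoff d n) x • φ x) q volume := by
    intro n
    rw [hdec n]
    exact eLpNorm_add_le (hmeas1 n) (hmeas2 n) hq1
  have hsum := h1.add h2
  rw [add_zero] at hsum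
  exact tendsto_of_tendsto_of_tendsto_of_le_of_le tendsto_const_nhds hsum (fun _ => zero_le) hle

/-! ### Limits of `Lᵖ` norms -/

/-- If `f_n → g` in `Lᵖ` (`1 ≤ p`, `‖g‖_p < ∞`) then `‖f_n‖_p → ‖g‖_p`. [folklore] -/
theorem tendsto_eLpNorm_of_tendsto_eLpNorm_sub {X F : Type*} [MeasurableSpace X] {μ : Measure X}
    [NormedAddCommGroup F] {f : ℕ → X → F} {g : X → F} {p : ℝ≥0∞}
    (hf : ∀ n, AEStronglyMeasurable (f n) μ) (hg : AEStronglyMeasurable g μ) (hp1 : 1 ≤ p)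
    (hgfin : eLpNorm g p μ ≠ ⊤) (h : Tendsto (fun n => eLpNorm (f n - g) p μ) atTop (𝓝 0)) :
    Tendsto (fun n => eLpNorm (f n) p μ) atTop (𝓝 (eLpNorm g p μ)) := by
  have hup : ∀ n, eLpNorm (f n) p μ ≤ eLpNorm g p μ + eLpNorm (f n - g) p μ := fun n => by
    have : f n = g + (f n - g) := by funext x; simp
    conv_lhs => rw [this]
    exact eLpNorm_add_le hg ((hf n).sub hg) hp1
  have hlow : ∀ n, eLpNorm g p μ - eLpNorm (f n - g) p μ ≤ eLpNorm (f n) p μ := fun n => by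
    refine tsub_le_iff_right.2 ?_
    have : g = f n - (f n - g) := by funext x; simp
    conv_lhs => rw [this]
    exact eLpNorm_sub_le (hf n) ((hf n).sub hg) hp1
  have h1 : Tendsto (fun n => eLpNorm g p μ + eLpNorm (f n - g) p μ) atTop (𝓝 (eLpNorm g p μ)) := by
    have := h.const_add (eLpNorm g p μ)
    rwa [add_zero] at this
  have h2 : Tendsto (fun n => eLpNorm g p μ - eLpNorm (f n - g) p μ) atTop (𝓝 (eLpNorm g p μ)) := by
    have := ENNReal.Tendsto.sub tendsto_const_nhds h (Or.inl hgfin)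
    rwa [tsub_zero] at this
  exact tendsto_of_tendsto_of_tendsto_of_le_of_le h2 h1 hlow hup

/-! ### The partial derivatives of the truncations as Schwartz functions -/

/-- `∂ⱼ` of a `C_c^∞` function is a Schwartz function. [folklore] -/
theorem exists_schwartz_coe_eq_partialDeriv {φ : EuclideanSpace ℝ (Fin d) → ι → ℂ}
    (hφ : ContDiff ℝ ∞ φ) (hc : HasCompactSupport φ) (j : Fin d) :
    ∃ g : 𝓢(EuclideanSpace ℝ (Fin d), ι → ℂ), ⇑g = partialDeriv j φ := by
  have h1 : ContDiff ℝ ∞ (partialDeriv j φ) := by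
    have := hφ.fderiv_right (m := ∞) (by norm_cast)
    exact this.clm_apply contDiff_const
  have h2 : HasCompactSupport (partialDeriv j φ) :=
    (hc.fderiv ℝ).mono fun x hx => by
      simp only [Function.mem_support, ne_eq, partialDeriv] at hx ⊢
      intro h0
      exact hx (by rw [h0, _root_.zero_apply])
  exact ⟨h2.toSchwartzMap h1, rfl⟩

/-- `M(D)` of a Schwartz function is continuous (bounded measurable symbol). [folklore] -/
theorem continuous_multiplierOp_schwartz {M : EuclideanSpace ℝ (Fin d) → Matrix κ ι ℂ}
    (hM : ∀ a b, Measurable fun ξ => M ξ a b) {C₀ : ℝ} (hC0 : 0 ≤ C₀)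
    (hC : ∀ ξ a b, ‖M ξ a b‖ ≤ C₀) (ψ : 𝓢(EuclideanSpace ℝ (Fin d), ι → ℂ)) :
    Continuous (multiplierOp M ⇑ψ) := by
  rw [multiplierOp_apply]
  exact continuous_fourierInv_of_integrable (integrable_mulVec_fourier hM hC0 hC ψ)

/-- `M(D)(f - g) = M(D)f - M(D)g` for Schwartz `f, g`. [folklore] -/
theorem multiplierOp_schwartz_sub {M : EuclideanSpace ℝ (Fin d) → Matrix κ ι ℂ}
    (hM : ∀ a b, Measurable fun ξ => M ξ a b) {C₀ : ℝ} (hC0 : 0 ≤ C₀)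
    (hC : ∀ ξ a b, ‖M ξ a b‖ ≤ C₀) (f g : 𝓢(EuclideanSpace ℝ (Fin d), ι → ℂ)) :
    multiplierOp M (⇑(f - g)) = multiplierOp M ⇑f - multiplierOp M ⇑g := by
  funext x
  rw [sub_eq_add_neg, ← neg_one_smul ℂ g, multiplierOp_schwartz_add hM hC0 hC,
    multiplierOp_schwartz_smul, Pi.sub_apply, neg_one_smul, sub_eq_add_neg]

/-! ### The bound on Schwartz test functions -/

/-- **The `Ẇ^{1,p}` bound of a bounded multiplier holds on Schwartz test functions.** If `M` is
bounded and entrywise measurable, `1 ≤ p < ∞` and `HasGradientLpBoundWith p c M` (test class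
`C_c^∞`), then for every Schwartz `φ` and every `j`,
`‖M(D)∂ⱼφ‖_{Lᵖ} ≤ c Σ_l ‖∂_lφ‖_{Lᵖ}` (truncation, `L²`-continuity of `M(D)`, a.e. convergent
subsequence, Fatou). [folklore] -/
theorem HasGradientLpBoundWith.eLpNorm_multiplierOp_partialDeriv_schwartz_le
    {M : EuclideanSpace ℝ (Fin d) → Matrix κ ι ℂ} (hM : ∀ a b, Measurable fun ξ => M ξ a b)
    {C₀ : ℝ≥0} (hC : ∀ ξ a b, ‖M ξ a b‖ ≤ C₀) {p : ℝ≥0∞} (hp1 : 1 ≤ p) (hp : p ≠ ⊤) {c : ℝ≥0}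
    (h : HasGradientLpBoundWith p c M) (φ : 𝓢(EuclideanSpace ℝ (Fin d), ι → ℂ)) (j : Fin d) :
    eLpNorm (multiplierOp M (partialDeriv j ⇑φ)) p volume ≤
      c * ∑ l, eLpNorm (partialDeriv l ⇑φ) p volume := by
  have hC0 : (0 : ℝ) ≤ C₀ := C₀.coe_nonneg
  -- the truncations and the bound on them
  set φn : ℕ → EuclideanSpace ℝ (Fin d) → ι → ℂ := fun n => truncate n ⇑φ with hφn
  have hbound : ∀ n, eLpNorm (multiplierOp M (partialDeriv j (φn n))) p volume ≤
      c * ∑ l, eLpNorm (partialDeriv l (φn n)) p volume := fun n =>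
    (Finset.single_le_sum (f := fun j => eLpNorm (multiplierOp M (partialDeriv j (φn n))) p volume)
      (fun _ _ => zero_le) (Finset.mem_univ j)).trans
      ((h (φn n) (truncate_contDiff n φ) (truncate_hasCompactSupport n φ)).2)
  -- Schwartz representatives of `∂ⱼφ_n` and `∂ⱼφ`
  have hgS : ∀ n, ∃ g : 𝓢(EuclideanSpace ℝ (Fin d), ι → ℂ), ⇑g = partialDeriv j (φn n) := fun n =>
    exists_schwartz_coe_eq_partialDeriv (truncate_contDiff n φ) (truncate_hasCompactSupport n φ) j
  choose gS hgS using hgS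
  open LineDeriv in
  set g : 𝓢(EuclideanSpace ℝ (Fin d), ι → ℂ) := ∂_{EuclideanSpace.single j (1 : ℝ)} φ with hgdef
  have hg : ⇑g = partialDeriv j ⇑φ := rfl
  -- `M(D)∂ⱼφ_n → M(D)∂ⱼφ` in `L²`
  set Fn : ℕ → EuclideanSpace ℝ (Fin d) → κ → ℂ := fun n => multiplierOp M (partialDeriv j (φn n))
    with hFn
  set F : EuclideanSpace ℝ (Fin d) → κ → ℂ := multiplierOp M (partialDeriv j ⇑φ) with hF
  have hFn_meas : ∀ n, AEStronglyMeasurable (Fn n) volume := fun n => by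
    rw [hFn]; dsimp only; rw [← hgS n]
    exact (continuous_multiplierOp_schwartz hM hC0 hC (gS n)).aestronglyMeasurable
  have hF_meas : AEStronglyMeasurable F volume := by
    rw [hF, ← hg]
    exact (continuous_multiplierOp_schwartz hM hC0 hC g).aestronglyMeasurable
  have hL2 : Tendsto (fun n => eLpNorm (Fn n - F) 2 volume) atTop (𝓝 0) := by
    have hdiff : ∀ n, Fn n - F = multiplierOp M (⇑(gS n - g)) := fun n => by
      rw [multiplierOp_schwartz_sub hM hC0 hC, hgS n, hg]
    have hle : ∀ n, eLpNorm (Fn n - F) 2 volume ≤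
        (Fintype.card κ * (Fintype.card ι * C₀) : ℝ≥0) *
          eLpNorm (partialDeriv j (φn n) - partialDeriv j ⇑φ) 2 volume := fun n => by
      rw [hdiff n, ← hgS n, ← hg]
      exact eLpNorm_multiplierOp_two_le hM hC (gS n - g)
    have hlim := tendsto_eLpNorm_partialDeriv_truncate_sub φ j one_le_two ENNReal.ofNat_ne_top
    have := ENNReal.Tendsto.const_mul hlim (Or.inr ENNReal.coe_ne_top)
      (a := ((Fintype.card κ * (Fintype.card ι * C₀) : ℝ≥0) : ℝ≥0∞))
    rw [mul_zero] at this
    exact tendsto_of_tendsto_of_tendsto_of_le_of_le tendsto_const_nhds this (fun _ => zero_le) hle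
  -- an a.e. convergent subsequence
  have hmeas := tendstoInMeasure_of_tendsto_eLpNorm two_ne_zero hFn_meas hF_meas hL2
  obtain ⟨ns, hns, hae⟩ := hmeas.exists_seq_tendsto_ae
  -- Fatou along the subsequence
  have hFatou : eLpNorm F p volume ≤ atTop.liminf fun i => eLpNorm (Fn (ns i)) p volume :=
    Lp.eLpNorm_lim_le_liminf_eLpNorm (fun i => hFn_meas (ns i)) F hae
  -- the right-hand sides converge
  have hR : Tendsto (fun i => (c : ℝ≥0∞) * ∑ l, eLpNorm (partialDeriv l (φn (ns i))) p volume) atTop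
      (𝓝 ((c : ℝ≥0∞) * ∑ l, eLpNorm (partialDeriv l ⇑φ) p volume)) := by
    refine ENNReal.Tendsto.const_mul ?_ (Or.inr ENNReal.coe_ne_top)
    refine tendsto_finsetSum _ fun l _ => ?_
    have hl : Tendsto (fun n => eLpNorm (partialDeriv l (φn n)) p volume) atTop
        (𝓝 (eLpNorm (partialDeriv l ⇑φ) p volume)) := by
      obtain ⟨gl, hgl⟩ : ∃ gl : ℕ → 𝓢(EuclideanSpace ℝ (Fin d), ι → ℂ),
          ∀ n, ⇑(gl n) = partialDeriv l (φn n) :=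
        ⟨fun n => (exists_schwartz_coe_eq_partialDeriv (truncate_contDiff n φ)
          (truncate_hasCompactSupport n φ) l).choose, fun n => (exists_schwartz_coe_eq_partialDeriv
            (truncate_contDiff n φ) (truncate_hasCompactSupport n φ) l).choose_spec⟩
      open LineDeriv in
      have hmeasl : ∀ n, AEStronglyMeasurable (partialDeriv l (φn n)) volume := fun n => by
        rw [← hgl n]; exact (gl n).continuous.aestronglyMeasurable
      have hmeasl' : AEStronglyMeasurable (partialDeriv l ⇑φ) volume :=
        (∂_{EuclideanSpace.single l (1 : ℝ)} φ :
          𝓢(EuclideanSpace ℝ (Fin d), ι → ℂ)).continuous.aestronglyMeasurable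
      have hfin : eLpNorm (partialDeriv l ⇑φ) p volume ≠ ⊤ :=
        ((∂_{EuclideanSpace.single l (1 : ℝ)} φ :
          𝓢(EuclideanSpace ℝ (Fin d), ι → ℂ)).eLpNorm_lt_top p volume).ne
      exact tendsto_eLpNorm_of_tendsto_eLpNorm_sub hmeasl hmeasl' hp1 hfin
        (tendsto_eLpNorm_partialDeriv_truncate_sub φ l hp1 hp)
    exact hl.comp hns.tendsto_atTop
  -- conclude
  calc eLpNorm F p volume ≤ atTop.liminf fun i => eLpNorm (Fn (ns i)) p volume := hFatou
    _ ≤ atTop.liminf fun i => (c : ℝ≥0∞) * ∑ l, eLpNorm (partialDeriv l (φn (ns i))) p volume :=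
        liminf_le_liminf (Eventually.of_forall fun i => hbound (ns i))
    _ = (c : ℝ≥0∞) * ∑ l, eLpNorm (partialDeriv l ⇑φ) p volume := hR.liminf_eq

end Literature.Analysis.Fourier

end
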